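import Literature.Probability.RandomPlanarGeometry.HexSAWArmchairWallBridges
import Literature.Probability.RandomPlanarGeometry.HexSAWHammersleyWelshLog
import HarnessLib

/-!
# Honeycomb SAW at Beaton's ROTATED (armchair) surface: the adsorbed phase is entropy-free at leading order —
# `√y ≤ β_rot(y) ≤ √y / (1 − 109/√y)` for `y > 109²`, hence `β_rot(y)/√y → 1` as `y → ∞`

Topic `Literature/Probability/RandomPlanarGeometry` (lane «pcv-sawmu», rotated-door lineage, rider «ARM-SQRT-ASYMPTOTIC»; continues
`HexSAWArmchairWallBridges.lean` — classes `hp`/`arches`/`wb`, weights `Cw`/`Aw`/`WB`, `visits`, the last-visit split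
`sum_fibre_lastV_le`, the Fekete rate `armRate y = β_rot(y)` with `WB_le_pow : B^w_n(y) ≤ β_rot(y)^{n+3}`).

Sources. N. R. Beaton, J. Phys. A 47 (2014) 075003 = arXiv:1210.0274v3, §3.1, Proposition 7 (p. 11: "for any `y > 0`,
`μ(y) ≥ max{μ, √y}`"; proof p. 14: "the lower bound `μ(y) ≥ √y` is obtained by considering walks which step along the surface").
J. M. Hammersley, G. M. Torrie, S. G. Whittington, J. Phys. A 15 (1982) 539 (unfolded surface walks / surface free energy of the hypercubic
lattice; as summarised by Beaton p. 11 — every "§2" locator below is PROVISIONAL: source not held, acq-10393).  G. Rychlewski, S. G. Whittington,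
J. Stat. Phys. 145 (2011) 661–668 (low-temperature behaviour: `μ(y) ∼ y` on the square lattice; not held).  N. R. Beaton, M. Bousquet-Mélou, J. de
Gier, H. Duminil-Copin, A. J. Guttmann, CMP 326 (2014) = arXiv:1109.0358v5, §3.1 (p. 10: "This translates into `μ(y) ∼ √y` in our honeycomb
setting" — the zig-zag boundary, stated without proof).  N. Madras, G. Slade, *The Self-Avoiding Walk* (1993),
§1.2 ((1.2.3): splitting a walk; Lemma 1.2.2 p. 9; (1.2.17) p. 11).  I. G. Enting, I. Jensen, LNP 775 (2009), §7.4.2, Fig. 7.10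
(brickwork form of the honeycomb lattice).

## What is proved (namespace `…SAW.HexBW.Arm`; `y ≥ 1` unless stated)

In the brick-wall frame the armchair wall `X = 0` carries its vertices in dimers `{(0,2k),(0,2k+1)}` and a walk can pass between
two dimers only through the column `X = 1`.  Consequently a half-plane walk ending on the wall (an ARCH) ends either with a single wall
vertex reached from `(1, Y)` (class `A`) or with a whole dimer (class `B`), and in class `A` the piece after the LAST-BUT-ONE wall
visit is either the forced three-step hook `(0,Y) (1,Y) (1,Y') (0,Y')` (`Y'` the vertical partner level) or has length `≥ 4`:

* `AwB_le : A^B_n(y) ≤ y · A^A_{n-1}(y)` (`n ≥ 2`; no three consecutive wall vertices), `Aw_eq_AwA_add_AwB`;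
* `AwA_le : A^A_n(y) ≤ y · A_{n-3}(y) + y · Σ_{k ≤ n-4} A_k(y) · c_{n-1-k}(ℍ)` (`n ≥ 3`; fibres of the last visit before time `n`:
  `k = n-1, n-2` empty, `k = n-3` forced, `k ≤ n-4` by Part A6's prefix / twisted-suffix injection);
* the recursion `Aw_le_rec` (`n ≥ 4`) and, by strong induction, **`Aw_le_mul_pow`**: if `ρ ≥ 6` and
  `y/ρ³ + y²/ρ⁴ + 54·y/ρ⁴ + 54·y²/ρ⁵ ≤ 1` then `A_n(y) ≤ 27 y⁴ · ρⁿ` for every `n` (with `c_m(ℍ) ≤ 3^m`);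
* `armRate_le_of_WB_le` (Fekete: `B^w_n ≤ M ρⁿ ∀ n ⇒ β_rot(y) ≤ ρ`), hence **`armRate_le_sqrt_div (hy : 109² < y) :
  β_rot(y) ≤ √y / (1 − 109/√y)`** and `armRate_pow_four_le : β_rot(y)⁴ ≤ y²/(1 − 109/√y)`;
* with `sqrt_le_armRate'` (`√y ≤ β_rot(y)`, the surface zig-zag; re-derived here) : **`tendsto_armRate_div_sqrt :
  β_rot(y)/√y → 1` as `y → ∞`** — the adsorbed phase of the rotated model has no residual entropy at leading order:
  `log β_rot(y) = ½ log y + O(y^{-1/2})`.  (By `HexSAWRotSurfaceArmRate.lean`, `β_rot(y)` IS Beaton's `μ(y)` for every `y > 0`.)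

Status in print (lit-1 g16, 2026-08-23): Beaton prints the lower bound only (Prop. 7, p. 11; p. 14).  The large-`y` asymptotics are
Rychlewski–Whittington's for the hypercubic lattice (J. Stat. Phys. 145 (2011) 661–668: "on the square lattice, `μ(y)` is asymptotic to `y`",
as quoted by BBdGDCG14, arXiv:1109.0358v5 pp. 9–10, and by Beaton–Guttmann–Jensen 2012 p. 2; source not held), and BBdGDCG14 (v5 p. 10) state
WITHOUT PROOF for the zig-zag honeycomb boundary: "This translates into `μ(y) ∼ √y` in our honeycomb setting."  For Beaton's ARMCHAIR boundary
the statement, a proof and the explicit rate `109/√y` are not in print; this file supplies them.  LABEL (lit-1 g16): NEW-IN-WRITING (S, modest: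
expected by analogy) — the armchair-boundary analogue of Rychlewski–Whittington's low-temperature asymptotics, with an explicit rate; elementary.
Refute-first face: the recursion `Aw_le_rec`, the class/fibre inequalities and `A_n(y) ≤ 27 y⁴ ρⁿ` are finitely checkable on the lane's
armchair enumerators.
EDITIONS: ed.1 8d89c80e5af429b6; ed.2 (this) = ed.1 + lit-1 g16's M1 (status-in-print paragraph, two cite tags) and M2 (HTW82 locator marked
provisional) — DOCSTRING-ONLY, code-identical.
-/

noncomputable section

open Finset Filter Function
open Literature.Probability.LatticeModels Literature.Probability.Percolation SimpleGraph
open _root_.Topology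

namespace Literature.Probability.RandomPlanarGeometry.SAW.HexBW.Arm

variable {y : ℝ} {n : ℕ} {ω : ℕ → Site 2}

/-! ### Elementary counts -/

/-- `c_m(ℍ) ≤ 3^m` (trivalence and submultiplicativity). [cite: MadrasSlade1993, §1.2, (1.2.3)] -/
theorem hexSawCount_le_three_pow (m : ℕ) : hexSawCount m ≤ 3 ^ m := by
  induction m with
  | zero => simp [hexSawCount_zero]
  | succ m ih =>
    calc hexSawCount (m + 1) ≤ hexSawCount m * hexSawCount 1 := hexSawCount_add_le m 1
      _ ≤ 3 ^ m * 3 := Nat.mul_le_mul ih hexSawCount_one_le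
      _ = 3 ^ (m + 1) := by ring

/-- `#(saws m) ≤ 3^m` as reals. [cite: MadrasSlade1993, §1.2, (1.2.3)] -/
theorem card_saws_le_three_pow (m : ℕ) : (#(saws m) : ℝ) ≤ 3 ^ m := by
  rw [card_saws]; exact_mod_cast hexSawCount_le_three_pow m

/-- A priori bound: `A_m(y) ≤ #(saws m) · max(1,y)^{m+1}`. [cite: MadrasSlade1993, §1.2, (1.2.3)] -/
theorem Aw_le_card_mul_pow (m : ℕ) (hy : 0 ≤ y) : Aw m y ≤ #(saws m) * max 1 y ^ (m + 1) := by
  calc Aw m y ≤ ∑ ω ∈ arches m, max 1 y ^ (m + 1) := Finset.sum_le_sum fun ω _ => by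
        calc y ^ visits m ω ≤ max 1 y ^ visits m ω := pow_le_pow_left₀ hy (le_max_right _ _) _
          _ ≤ max 1 y ^ (m + 1) := pow_le_pow_right₀ (le_max_left _ _) (visits_le m ω)
    _ = #(arches m) * max 1 y ^ (m + 1) := by rw [Finset.sum_const, nsmul_eq_mul]
    _ ≤ #(saws m) * max 1 y ^ (m + 1) := by
        gcongr
        exact arches_subset.trans hp_subset

/-- No three consecutive wall vertices: two consecutive vertical bonds in the column `X = 0` are impossible (a dimer step up starts
at an even level and arrives at an odd one). [cite: EntingJensen2009, §7.4.2, Fig. 7.10 (brickwork form of the honeycomb lattice)] -/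
private theorem three_walls_false (hω : ω ∈ saws n) {i : ℕ} (hi : i + 2 ≤ n) (h0 : ω i 0 = 0) (h1 : ω (i + 1) 0 = 0)
    (h2 : ω (i + 2) 0 = 0) : False := by
  obtain ⟨-, -, hbw, hinj⟩ := mem_saws_iff.1 hω
  have s1 := step_cases (hbw i (by omega))
  have s2 := step_cases (hbw (i + 1) (by omega))
  rw [show i + 1 + 1 = i + 2 by omega] at s2
  have hne : ω i ≠ ω (i + 2) := fun h => by
    have := hinj (show i ∈ {j | j ≤ n} by simp only [Set.mem_setOf_eq]; omega)
      (show i + 2 ∈ {j | j ≤ n} by simp only [Set.mem_setOf_eq]; omega) h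
    omega
  have hne1 : ω i 1 ≠ ω (i + 2) 1 := fun h => hne ((site_two_eq_iff _ _).2 ⟨by rw [h0, h2], h⟩)
  omega

/-! ### The two end classes of arches -/

open Classical in
/-- **`A^A_n(y)`**: weighted arches whose last-but-one vertex is OFF the wall (the end is a single wall vertex reached from `(1, Y_n)`).
[cite: HammersleyTorrieWhittington1982, §2 (unfolded surface walks, as summarised by Beaton 2014 arXiv v3 p. 11; locator provisional, source not held)] -/
def AwA (n : ℕ) (y : ℝ) : ℝ := ∑ ω ∈ (arches n).filter (fun ω => ω (n - 1) 0 ≠ 0), y ^ visits n ω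

open Classical in
/-- **`A^B_n(y)`**: weighted arches whose last-but-one vertex is ON the wall (the end is a wall dimer).
[cite: HammersleyTorrieWhittington1982, §2 (unfolded surface walks, as summarised by Beaton 2014 arXiv v3 p. 11; locator provisional, source not held)] -/
def AwB (n : ℕ) (y : ℝ) : ℝ := ∑ ω ∈ (arches n).filter (fun ω => ¬ ω (n - 1) 0 ≠ 0), y ^ visits n ω

open Classical in
/-- `A_n = A^A_n + A^B_n`. [cite: HammersleyTorrieWhittington1982, §2 (unfolded surface walks, as summarised by Beaton 2014 arXiv v3 p. 11; locator provisional, source not held)] -/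
theorem Aw_eq_AwA_add_AwB (n : ℕ) (y : ℝ) : Aw n y = AwA n y + AwB n y := by
  rw [Aw, AwA, AwB, Finset.sum_filter_add_sum_filter_not]

/-- `A^A_n ≥ 0`. [cite: HammersleyTorrieWhittington1982, §2 (as summarised by Beaton 2014 arXiv v3 p. 11; locator provisional)] -/
theorem AwA_nonneg (n : ℕ) (hy : 0 ≤ y) : 0 ≤ AwA n y := by
  classical exact Finset.sum_nonneg fun _ _ => pow_nonneg hy _

/-- `A^B_n ≥ 0`. [cite: HammersleyTorrieWhittington1982, §2 (as summarised by Beaton 2014 arXiv v3 p. 11; locator provisional)] -/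
theorem AwB_nonneg (n : ℕ) (hy : 0 ≤ y) : 0 ≤ AwB n y := by
  classical exact Finset.sum_nonneg fun _ _ => pow_nonneg hy _

/-- `A^A_n ≤ A_n`. [cite: HammersleyTorrieWhittington1982, §2 (as summarised by Beaton 2014 arXiv v3 p. 11; locator provisional)] -/
theorem AwA_le_Aw (n : ℕ) (hy : 0 ≤ y) : AwA n y ≤ Aw n y := by
  rw [Aw_eq_AwA_add_AwB]; exact le_add_of_nonneg_right (AwB_nonneg n hy)

/-- A vertical wall step is determined by its start: from `(0, Y)` the wall neighbour is `(0, Y+1)` if `Y` is even and `(0, Y-1)` if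
`Y` is odd. [cite: EntingJensen2009, §7.4.2, Fig. 7.10 (brickwork form of the honeycomb lattice)] -/
theorem wall_step_eq {x z : Site 2} (h : brickWallGraph.Adj x z) (hx : x 0 = 0) (hz : z 0 = 0) :
    z 1 = x 1 + (if x 1 % 2 = 0 then 1 else -1) := by
  have s := step_cases h
  split_ifs with he <;> omega

/-- A vertex has at most one neighbour on the wall: if `x ∼ z`, `x ∼ z'` with `z, z'` on the wall then `z = z'`.
[cite: EntingJensen2009, §7.4.2, Fig. 7.10 (brickwork form of the honeycomb lattice)] -/
theorem wall_nbr_unique {x z z' : Site 2} (h : brickWallGraph.Adj x z) (h' : brickWallGraph.Adj x z')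
    (hz : z 0 = 0) (hz' : z' 0 = 0) : z = z' := by
  have s := step_cases h
  have s' := step_cases h'
  rw [site_two_eq_iff]
  omega

/-- Extensionality for `n`-step walks frozen after `n`: agreement at times `≤ n` is agreement. [cite: MadrasSlade1993, §1.1] -/
theorem eq_of_agree (hω : ω ∈ saws n) {ξ : ℕ → Site 2} (hξ : ξ ∈ saws n) (h : ∀ i ≤ n, ω i = ξ i) : ω = ξ := by
  obtain ⟨-, hfr, -, -⟩ := mem_saws_iff.1 hω
  obtain ⟨-, hfr', -, -⟩ := mem_saws_iff.1 hξ
  funext i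
  rcases Nat.lt_or_ge n i with hi | hi
  · rw [hfr i hi.le, hfr' i hi.le, h n le_rfl]
  · exact h i hi


/-- `lastV` only reads times `≤ m`: it agrees on the prefix walk. [cite: HammersleyTorrieWhittington1982, §2 (unfolded surface walks, as summarised by Beaton 2014 arXiv v3 p. 11; locator provisional, source not held)] -/
theorem lastV_prefixWalk (m : ℕ) (ω : ℕ → Site 2) : lastV m (Zd.prefixWalk m ω) = lastV m ω := by
  unfold lastV
  have key : ∀ j ≤ m, Nat.findGreatest (fun i => Zd.prefixWalk m ω i 0 = 0) j = Nat.findGreatest (fun i => ω i 0 = 0) j := by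
    intro j hj
    induction j with
    | zero => rfl
    | succ j ih =>
      rw [Nat.findGreatest_succ, Nat.findGreatest_succ, ih (by omega)]
      have : Zd.prefixWalk m ω (j + 1) = ω (j + 1) := by simp [Zd.prefixWalk, min_eq_left hj]
      simp only [this]
  exact key m le_rfl

/-! ### Class `B`: drop the final dimer step -/

open Classical in
/-- **`A^B_n(y) ≤ y · A^A_{n-1}(y)`** (`n ≥ 2`, `y ≥ 0`): the prefix of a class-`B` arch is a class-`A` arch (no three consecutive wall
vertices) with one visit less, and the final dimer step is recovered from the parity of its start.
[cite: HammersleyTorrieWhittington1982, §2 (as summarised by Beaton 2014 arXiv v3 p. 11; locator provisional); EntingJensen2009, §7.4.2, Fig. 7.10] -/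
theorem AwB_le (m : ℕ) (hy : 0 ≤ y) : AwB (m + 2) y ≤ y * AwA (m + 1) y := by
  set FB := (arches (m + 2)).filter (fun ω => ¬ ω (m + 2 - 1) 0 ≠ 0) with hFB
  set g : (ℕ → Site 2) → (ℕ → Site 2) := fun ω => Zd.prefixWalk (m + 1) ω with hg
  have hprops : ∀ ω ∈ FB, g ω ∈ (arches (m + 1)).filter (fun ω => ω (m + 1 - 1) 0 ≠ 0) ∧
      visits (m + 2) ω = visits (m + 1) (g ω) + 1 := by
    intro ω hω
    obtain ⟨hωa, hB⟩ := Finset.mem_filter.1 hω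
    have hB' : ω (m + 1) 0 = 0 := by rw [show m + 2 - 1 = m + 1 by omega] at hB; simpa using hB
    obtain ⟨hωh, hend⟩ := mem_arches.1 hωa
    have hωs := hp_subset hωh
    obtain ⟨hpa, hpv⟩ := prefixWalk_mem_arches hωh (show m + 1 ≤ m + 2 by omega) hB'
    refine ⟨Finset.mem_filter.2 ⟨hpa, ?_⟩, ?_⟩
    · have e : g ω (m + 1 - 1) = ω m := by simp [hg, Zd.prefixWalk, show m + 1 - 1 = m by omega]
      rw [e]
      intro h2
      exact three_walls_false hωs (i := m) (by omega) h2 hB' hend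
    · rw [show m + 2 = m + 1 + 1 by omega, visits_succ, if_pos hend, hpv]
  have hinj : Set.InjOn g ↑FB := by
    intro ω hω ω' hω' h
    rw [Finset.mem_coe] at hω hω'
    obtain ⟨hωa, hB⟩ := Finset.mem_filter.1 hω
    obtain ⟨hωa', hB'⟩ := Finset.mem_filter.1 hω'
    have hBe : ω (m + 1) 0 = 0 := by rw [show m + 2 - 1 = m + 1 by omega] at hB; simpa using hB
    have hBe' : ω' (m + 1) 0 = 0 := by rw [show m + 2 - 1 = m + 1 by omega] at hB'; simpa using hB'
    obtain ⟨hωh, hend⟩ := mem_arches.1 hωa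
    obtain ⟨hωh', hend'⟩ := mem_arches.1 hωa'
    have hωs := hp_subset hωh
    have hωs' := hp_subset hωh'
    have hagree : ∀ i ≤ m + 1, ω i = ω' i := fun i hi => by
      have := congrFun h i
      simpa [hg, Zd.prefixWalk, min_eq_left hi] using this
    refine eq_of_agree hωs hωs' fun i hi => ?_
    rcases Nat.lt_or_ge i (m + 2) with hi' | hi'
    · exact hagree i (by omega)
    · have hin : i = m + 2 := le_antisymm hi hi'
      subst hin
      obtain ⟨-, -, hbw, -⟩ := mem_saws_iff.1 hωs
      obtain ⟨-, -, hbw', -⟩ := mem_saws_iff.1 hωs'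
      have hst := hbw (m + 1) (by omega)
      have hst' := hbw' (m + 1) (by omega)
      have e1 := wall_step_eq hst hBe hend
      have e1' := wall_step_eq hst' hBe' hend'
      rw [site_two_eq_iff]
      refine ⟨by rw [hend, hend'], ?_⟩
      rw [e1, e1', hagree (m + 1) le_rfl]
  calc AwB (m + 2) y = ∑ ω ∈ FB, y ^ visits (m + 2) ω := rfl
    _ = ∑ ω ∈ FB, y * y ^ visits (m + 1) (g ω) := Finset.sum_congr rfl fun ω hω => by
        rw [(hprops ω hω).2, pow_succ, mul_comm]
    _ = y * ∑ ω ∈ FB, y ^ visits (m + 1) (g ω) := by rw [Finset.mul_sum]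
    _ = y * ∑ ξ ∈ FB.image g, y ^ visits (m + 1) ξ := by rw [Finset.sum_image hinj]
    _ ≤ y * AwA (m + 1) y := by
        refine mul_le_mul_of_nonneg_left ?_ hy
        rw [AwA]
        refine Finset.sum_le_sum_of_subset_of_nonneg (fun ξ hξ => ?_) fun _ _ _ => pow_nonneg hy _
        obtain ⟨ω, hω, rfl⟩ := Finset.mem_image.1 hξ
        exact (hprops ω hω).1

/-! ### Class `A`: the fibres of the last wall visit before the end -/

open Classical in
/-- The fibre of class-`A` arches of length `m+3` whose last wall visit before the end is at time `k`. [cite: HammersleyTorrieWhittington1982, §2 (unfolded surface walks, as summarised by Beaton 2014 arXiv v3 p. 11; locator provisional, source not held)] -/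
def fibA (m k : ℕ) : Finset (ℕ → Site 2) :=
  ((arches (m + 3)).filter (fun ω => ω (m + 3 - 1) 0 ≠ 0)).filter (fun ω => lastV (m + 2) ω = k)

open Classical in
/-- Anatomy of a member of the fibre: arch data, the last-but-one visit at `k ≤ m+2`, off the wall strictly between `k` and `m+3`.
[cite: HammersleyTorrieWhittington1982, §2 (unfolded surface walks, as summarised by Beaton 2014 arXiv v3 p. 11; locator provisional, source not held)] -/
theorem fibA_anatomy {m k : ℕ} (hω : ω ∈ fibA m k) :
    ω ∈ hp (m + 3) ∧ ω (m + 3) 0 = 0 ∧ k ≤ m + 2 ∧ ω k 0 = 0 ∧ (∀ i, k < i → i ≤ m + 2 → ω i 0 ≠ 0) := by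
  obtain ⟨hω1, hk⟩ := Finset.mem_filter.1 hω
  obtain ⟨hωa, hA⟩ := Finset.mem_filter.1 hω1
  obtain ⟨hωh, hend⟩ := mem_arches.1 hωa
  obtain ⟨h0, -, -, -⟩ := mem_saws_iff.1 (hp_subset hωh)
  refine ⟨hωh, hend, hk ▸ lastV_le _ _, hk ▸ lastV_spec h0, fun i hi1 hi2 => ?_⟩
  exact not_visit_of_lastV_lt (n := m + 2) (by rw [hk]; exact hi1) hi2

open Classical in
/-- The fibre `k = m+2` is empty (the last-but-one vertex of a class-`A` arch is off the wall). [cite: HammersleyTorrieWhittington1982, §2 (as summarised by Beaton 2014 arXiv v3 p. 11; locator provisional)] -/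
theorem fibA_top_eq_empty (m : ℕ) : fibA m (m + 2) = ∅ := by
  refine Finset.eq_empty_of_forall_notMem fun ω hω => ?_
  obtain ⟨hω1, hk⟩ := Finset.mem_filter.1 hω
  obtain ⟨hωa, hA⟩ := Finset.mem_filter.1 hω1
  obtain ⟨hωh, -⟩ := mem_arches.1 hωa
  obtain ⟨h0, -, -, -⟩ := mem_saws_iff.1 (hp_subset hωh)
  have := lastV_spec (n := m + 2) (ω := ω) h0
  rw [hk] at this
  rw [show m + 3 - 1 = m + 2 by omega] at hA
  exact hA this

open Classical in
/-- The fibre `k = m+1` is empty: `(0,Y) (1,Y) (0,Y)` would revisit the wall vertex. [cite: EntingJensen2009, §7.4.2, Fig. 7.10] -/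
theorem fibA_pred_eq_empty (m : ℕ) : fibA m (m + 1) = ∅ := by
  refine Finset.eq_empty_of_forall_notMem fun ω hω => ?_
  obtain ⟨hωh, hend, -, hk0, hoff⟩ := fibA_anatomy hω
  obtain ⟨hωs, hH⟩ := mem_hp.1 hωh
  obtain ⟨-, -, hbw, hinj⟩ := mem_saws_iff.1 hωs
  have h2 := hoff (m + 2) (by omega) le_rfl
  have s1 := step_cases (hbw (m + 1) (by omega))
  have s2 := step_cases (hbw (m + 2) (by omega))
  rw [show m + 1 + 1 = m + 2 by omega] at s1
  rw [show m + 2 + 1 = m + 3 by omega] at s2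
  have hne : ω (m + 1) ≠ ω (m + 3) := fun h => by
    have := hinj (show m + 1 ∈ {j | j ≤ m + 3} by simp only [Set.mem_setOf_eq]; omega)
      (show m + 3 ∈ {j | j ≤ m + 3} by simp only [Set.mem_setOf_eq]; exact le_rfl) h
    omega
  have hne1 : ω (m + 1) 1 ≠ ω (m + 3) 1 := fun h => hne ((site_two_eq_iff _ _).2 ⟨by rw [hk0, hend], h⟩)
  omega

open Classical in
/-- **The fibre `k = m` is FORCED**: `(0,Y) (1,Y) (1,Y') (0,Y')` with `Y'` the vertical partner level of `(1,Y)`; its weight is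
`≤ y · A_m(y)` (prefix injection, one new visit). [cite: EntingJensen2009, §7.4.2, Fig. 7.10; HammersleyTorrieWhittington1982, §2] -/
theorem sum_fibA_self_le (m : ℕ) (hy : 0 ≤ y) : ∑ ω ∈ fibA m m, y ^ visits (m + 3) ω ≤ y * Aw m y := by
  set g : (ℕ → Site 2) → (ℕ → Site 2) := fun ω => Zd.prefixWalk m ω with hg
  -- coordinates of the three last vertices in terms of `Y_m`
  have hcoord : ∀ ω ∈ fibA m m, ω (m + 1) 0 = 1 ∧ ω (m + 1) 1 = ω m 1 ∧ ω (m + 2) 0 = 1 ∧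
      ω (m + 2) 1 = ω m 1 + (if (1 + ω m 1) % 2 = 0 then 1 else -1) ∧ ω (m + 3) 0 = 0 ∧ ω (m + 3) 1 = ω (m + 2) 1 := by
    intro ω hω
    obtain ⟨hωh, hend, -, hk0, hoff⟩ := fibA_anatomy hω
    obtain ⟨hωs, hH⟩ := mem_hp.1 hωh
    obtain ⟨-, -, hbw, -⟩ := mem_saws_iff.1 hωs
    have h1 := hoff (m + 1) (by omega) (by omega)
    have h2 := hoff (m + 2) (by omega) le_rfl
    have hX1 := hH (m + 1) (by omega)
    have hX2 := hH (m + 2) (by omega)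
    have s0 := step_cases (hbw m (by omega))
    have s1 := step_cases (hbw (m + 1) (by omega))
    have s2 := step_cases (hbw (m + 2) (by omega))
    rw [show m + 1 + 1 = m + 2 by omega] at s1
    rw [show m + 2 + 1 = m + 3 by omega] at s2
    refine ⟨by omega, by omega, by omega, ?_, hend, by omega⟩
    split_ifs with he <;> omega
  have hprops : ∀ ω ∈ fibA m m, g ω ∈ arches m ∧ visits (m + 3) ω = visits m (g ω) + 1 := by
    intro ω hω
    obtain ⟨hωh, hend, -, hk0, hoff⟩ := fibA_anatomy hω
    obtain ⟨hpa, hpv⟩ := prefixWalk_mem_arches hωh (show m ≤ m + 3 by omega) hk0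
    refine ⟨hpa, ?_⟩
    have h1 := hoff (m + 1) (by omega) (by omega)
    have h2 := hoff (m + 2) (by omega) le_rfl
    rw [show m + 3 = m + 2 + 1 by omega, visits_succ, if_pos hend, show m + 2 = m + 1 + 1 by omega, visits_succ, if_neg h2,
      visits_succ, if_neg h1, hpv]
  have hinj : Set.InjOn g ↑(fibA m m) := by
    intro ω hω ω' hω' h
    rw [Finset.mem_coe] at hω hω'
    have hc := hcoord ω hω
    have hc' := hcoord ω' hω'
    have hωs := hp_subset (fibA_anatomy hω).1
    have hωs' := hp_subset (fibA_anatomy hω').1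
    have hagree : ∀ i ≤ m, ω i = ω' i := fun i hi => by
      have := congrFun h i
      simpa [hg, Zd.prefixWalk, min_eq_left hi] using this
    have hYm : ω m 1 = ω' m 1 := by rw [hagree m le_rfl]
    refine eq_of_agree hωs hωs' fun i hi => ?_
    rcases Nat.lt_or_ge i (m + 1) with hi' | hi'
    · exact hagree i (by omega)
    · rw [site_two_eq_iff]
      obtain ⟨a0, a1, b0, b1, c0, c1⟩ := hc
      obtain ⟨a0', a1', b0', b1', c0', c1'⟩ := hc'
      rw [hYm] at a1 b1
      have hcase : i = m + 1 ∨ i = m + 2 ∨ i = m + 3 := by omega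
      rcases hcase with rfl | rfl | rfl
      · exact ⟨by rw [a0, a0'], by rw [a1, a1']⟩
      · exact ⟨by rw [b0, b0'], by rw [b1, b1']⟩
      · exact ⟨by rw [c0, c0'], by rw [c1, c1', b1, b1']⟩
  calc ∑ ω ∈ fibA m m, y ^ visits (m + 3) ω = ∑ ω ∈ fibA m m, y * y ^ visits m (g ω) :=
        Finset.sum_congr rfl fun ω hω => by rw [(hprops ω hω).2, pow_succ, mul_comm]
    _ = y * ∑ ω ∈ fibA m m, y ^ visits m (g ω) := by rw [Finset.mul_sum]
    _ = y * ∑ ξ ∈ (fibA m m).image g, y ^ visits m ξ := by rw [Finset.sum_image hinj]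
    _ ≤ y * Aw m y := by
        refine mul_le_mul_of_nonneg_left ?_ hy
        rw [Aw]
        refine Finset.sum_le_sum_of_subset_of_nonneg (fun ξ hξ => ?_) fun _ _ _ => pow_nonneg hy _
        obtain ⟨ω, hω, rfl⟩ := Finset.mem_image.1 hξ
        exact (hprops ω hω).1

/-- A prefix of a half-plane walk is a half-plane walk with the same visits up to that time. [cite: MadrasSlade1993, §1.2, (1.2.3)] -/
theorem prefixWalk_mem_hp (hω : ω ∈ hp n) {k : ℕ} (hk : k ≤ n) :
    Zd.prefixWalk k ω ∈ hp k ∧ visits k (Zd.prefixWalk k ω) = visits k ω := by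
  obtain ⟨hωs, hH⟩ := mem_hp.1 hω
  obtain ⟨h0, -, hbw, -⟩ := mem_saws_iff.1 hωs
  have hv : ∀ i ≤ k, Zd.prefixWalk k ω i = ω i := fun i hi => by simp [Zd.prefixWalk, min_eq_left hi]
  refine ⟨mem_hp.2 ⟨mem_saws.2 ⟨Zd.prefixWalk_mem_saws (saws_subset _ hωs) hk, fun i hi => ?_⟩, fun i hi => ?_⟩,
    visits_congr fun i hi => by rw [hv i hi]⟩
  · rw [hv i hi.le, hv (i + 1) (by omega)]; exact hbw i (by omega)
  · rw [hv i hi]; exact hH i (by omega)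

open Classical in
/-- **The long fibres `k ≤ m-1`** (and in fact every fibre): weight `≤ y · A_k(y) · c_{m+2-k}(ℍ)` — drop the last step (recovered as THE
wall neighbour of `ω_{m+2}`), then Part A6's prefix / twisted-suffix split of the `(m+2)`-step prefix at its last visit `k`.
[cite: HammersleyTorrieWhittington1982, §2 (as summarised by Beaton 2014 arXiv v3 p. 11; locator provisional); MadrasSlade1993, §1.2, (1.2.3)] -/
theorem sum_fibA_le (m : ℕ) (hy : 0 ≤ y) {k : ℕ} (hk : k ≤ m + 2) :
    ∑ ω ∈ fibA m k, y ^ visits (m + 3) ω ≤ y * (Aw k y * #(saws (m + 2 - k))) := by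
  set g : (ℕ → Site 2) → (ℕ → Site 2) := fun ω => Zd.prefixWalk (m + 2) ω with hg
  have hprops : ∀ ω ∈ fibA m k, g ω ∈ (hp (m + 2)).filter (fun ξ => lastV (m + 2) ξ = k) ∧
      visits (m + 3) ω = visits (m + 2) (g ω) + 1 := by
    intro ω hω
    obtain ⟨hωh, hend, -, -, -⟩ := fibA_anatomy hω
    obtain ⟨-, hkk⟩ := Finset.mem_filter.1 hω
    obtain ⟨hph, hpv⟩ := prefixWalk_mem_hp hωh (show m + 2 ≤ m + 3 by omega)
    refine ⟨Finset.mem_filter.2 ⟨hph, (lastV_prefixWalk _ _).trans hkk⟩, ?_⟩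
    rw [show m + 3 = m + 2 + 1 by omega, visits_succ, if_pos hend, hpv]
  have hinj : Set.InjOn g ↑(fibA m k) := by
    intro ω hω ω' hω' h
    rw [Finset.mem_coe] at hω hω'
    obtain ⟨hωh, hend, -, -, -⟩ := fibA_anatomy hω
    obtain ⟨hωh', hend', -, -, -⟩ := fibA_anatomy hω'
    have hωs := hp_subset hωh
    have hωs' := hp_subset hωh'
    have hagree : ∀ i ≤ m + 2, ω i = ω' i := fun i hi => by
      have := congrFun h i
      simpa [hg, Zd.prefixWalk, min_eq_left hi] using this
    refine eq_of_agree hωs hωs' fun i hi => ?_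
    rcases Nat.lt_or_ge i (m + 3) with hi' | hi'
    · exact hagree i (by omega)
    · have hin : i = m + 3 := le_antisymm hi hi'
      rw [hin]
      obtain ⟨-, -, hbw, -⟩ := mem_saws_iff.1 hωs
      obtain ⟨-, -, hbw', -⟩ := mem_saws_iff.1 hωs'
      have hst := hbw (m + 2) (by omega)
      have hst' := hbw' (m + 2) (by omega)
      rw [show m + 2 + 1 = m + 3 by omega] at hst hst'
      rw [hagree (m + 2) le_rfl] at hst
      exact wall_nbr_unique hst hst' hend hend'
  calc ∑ ω ∈ fibA m k, y ^ visits (m + 3) ω = ∑ ω ∈ fibA m k, y * y ^ visits (m + 2) (g ω) :=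
        Finset.sum_congr rfl fun ω hω => by rw [(hprops ω hω).2, pow_succ, mul_comm]
    _ = y * ∑ ξ ∈ (fibA m k).image g, y ^ visits (m + 2) ξ := by rw [Finset.mul_sum, Finset.sum_image hinj]
    _ ≤ y * ∑ ξ ∈ (hp (m + 2)).filter (fun ξ => lastV (m + 2) ξ = k), y ^ visits (m + 2) ξ := by
        refine mul_le_mul_of_nonneg_left ?_ hy
        refine Finset.sum_le_sum_of_subset_of_nonneg (fun ξ hξ => ?_) fun _ _ _ => pow_nonneg hy _
        obtain ⟨ω, hω, rfl⟩ := Finset.mem_image.1 hξ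
        exact (hprops ω hω).1
    _ ≤ y * (Aw k y * #(saws (m + 2 - k))) := mul_le_mul_of_nonneg_left (sum_fibre_lastV_le (n := m + 2) hy hk) hy

open Classical in
/-- `A^A_{m+3}` is the sum of its fibres. [cite: HammersleyTorrieWhittington1982, §2 (unfolded surface walks, as summarised by Beaton 2014 arXiv v3 p. 11; locator provisional, source not held)] -/
theorem AwA_eq_sum_fibA (m : ℕ) (y : ℝ) :
    AwA (m + 3) y = ∑ k ∈ range (m + 3), ∑ ω ∈ fibA m k, y ^ visits (m + 3) ω := by
  have hf : ∀ ω ∈ (arches (m + 3)).filter (fun ω => ω (m + 3 - 1) 0 ≠ 0), lastV (m + 2) ω ∈ range (m + 3) :=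
    fun ω _ => Finset.mem_range.2 (Nat.lt_succ_of_le (lastV_le _ _))
  rw [AwA, ← Finset.sum_fiberwise_of_maps_to hf]
  rfl

/-- **`A^A_{m+3}(y) ≤ y · A_m(y) + y · Σ_{k < m} A_k(y) · c_{m+2-k}(ℍ)`** (`y ≥ 0`): the fibres `k = m+2, m+1` are empty, `k = m` is
forced, `k < m` by the prefix/suffix injection. [cite: HammersleyTorrieWhittington1982, §2 (as summarised by Beaton 2014 arXiv v3 p. 11; locator provisional); MadrasSlade1993, §1.2, (1.2.3)] -/
theorem AwA_le (m : ℕ) (hy : 0 ≤ y) :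
    AwA (m + 3) y ≤ y * Aw m y + y * ∑ k ∈ range m, Aw k y * #(saws (m + 2 - k)) := by
  rw [AwA_eq_sum_fibA, Finset.sum_range_succ, Finset.sum_range_succ, Finset.sum_range_succ, fibA_top_eq_empty,
    fibA_pred_eq_empty]
  simp only [Finset.sum_empty, add_zero]
  have h1 : ∑ k ∈ range m, ∑ ω ∈ fibA m k, y ^ visits (m + 3) ω ≤ y * ∑ k ∈ range m, Aw k y * #(saws (m + 2 - k)) := by
    rw [Finset.mul_sum]
    exact Finset.sum_le_sum fun k hk => sum_fibA_le m hy (by have := Finset.mem_range.1 hk; omega)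
  have h2 := sum_fibA_self_le m hy
  linarith

/-! ### The recursion and the growth bound -/

/-- **The recursion** (`y ≥ 0`): `A_{m+4} ≤ y A_{m+1} + y Σ_{k ≤ m} A_k c_{m+3-k} + y (y A_m + y Σ_{k < m} A_k c_{m+2-k})`.
[cite: HammersleyTorrieWhittington1982, §2 (unfolded surface walks, as summarised by Beaton 2014 arXiv v3 p. 11; locator provisional, source not held)] -/
theorem Aw_le_rec (m : ℕ) (hy : 0 ≤ y) :
    Aw (m + 4) y ≤ y * Aw (m + 1) y + y * ∑ k ∈ range (m + 1), Aw k y * #(saws (m + 3 - k)) +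
      y * (y * Aw m y + y * ∑ k ∈ range m, Aw k y * #(saws (m + 2 - k))) := by
  rw [Aw_eq_AwA_add_AwB]
  have hA := AwA_le (m + 1) hy
  have hB := AwB_le (m + 2) hy
  have hA' := AwA_le m hy
  rw [show m + 1 + 3 = m + 4 by omega] at hA
  rw [show m + 2 + 2 = m + 4 by omega, show m + 2 + 1 = m + 3 by omega] at hB
  have e : ∑ k ∈ range (m + 1), Aw k y * (#(saws (m + 1 + 2 - k)) : ℝ) = ∑ k ∈ range (m + 1), Aw k y * #(saws (m + 3 - k)) :=
    Finset.sum_congr rfl fun k _ => by rw [show m + 1 + 2 - k = m + 3 - k by omega]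
  rw [e] at hA
  have hB' : AwB (m + 4) y ≤ y * (y * Aw m y + y * ∑ k ∈ range m, Aw k y * #(saws (m + 2 - k))) :=
    hB.trans (mul_le_mul_of_nonneg_left hA' hy)
  linarith

/-- A geometric comparison: for `ρ ≥ 6`, `Σ_{k ≤ m} ρ^k 3^{m+s-k} ≤ 2 · 3^s · ρ^m` (`3/ρ ≤ 1/2`). [cite: MadrasSlade1993, §1.2, Lemma 1.2.2] -/
theorem sum_pow_mul_three_pow_le {ρ : ℝ} (hρ : 6 ≤ ρ) (m s : ℕ) : ∑ k ∈ range (m + 1), ρ ^ k * (3 : ℝ) ^ (m + s - k) ≤ 2 * 3 ^ s * ρ ^ m := by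
  have hρ0 : 0 < ρ := by linarith
  have hq0 : (0 : ℝ) ≤ 3 / ρ := by positivity
  have hq : (3 : ℝ) / ρ ≤ 1 / 2 := by rw [div_le_div_iff₀ hρ0 (by norm_num : (0:ℝ) < 2)]; linarith
  have hterm : ∀ k ∈ range (m + 1), ρ ^ k * (3 : ℝ) ^ (m + s - k) = 3 ^ s * ρ ^ m * (3 / ρ) ^ (m - k) := by
    intro k hk
    have hkm : k ≤ m := Nat.lt_succ_iff.1 (Finset.mem_range.1 hk)
    have hρm : ρ ^ m = ρ ^ k * ρ ^ (m - k) := by rw [← pow_add, Nat.add_sub_cancel' hkm]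
    rw [show m + s - k = s + (m - k) by omega, pow_add, div_pow, hρm]
    field_simp
  calc ∑ k ∈ range (m + 1), ρ ^ k * (3 : ℝ) ^ (m + s - k) = ∑ k ∈ range (m + 1), 3 ^ s * ρ ^ m * (3 / ρ) ^ (m - k) :=
        Finset.sum_congr rfl hterm
    _ = 3 ^ s * ρ ^ m * ∑ k ∈ range (m + 1), (3 / ρ) ^ (m - k) := by rw [Finset.mul_sum]
    _ = 3 ^ s * ρ ^ m * ∑ k ∈ range (m + 1), (3 / ρ) ^ k := by
        congr 1
        have := Finset.sum_range_reflect (fun k => (3 / ρ : ℝ) ^ k) (m + 1)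
        rw [← this]
        refine Finset.sum_congr rfl fun k hk => ?_
        rw [show m + 1 - 1 - k = m - k by omega]
    _ ≤ 3 ^ s * ρ ^ m * ∑ k ∈ range (m + 1), (1 / 2 : ℝ) ^ k := by
        gcongr
    _ ≤ 3 ^ s * ρ ^ m * 2 := by gcongr; exact sum_geometric_two_le _
    _ = 2 * 3 ^ s * ρ ^ m := by ring

/-- **The growth bound** (`y ≥ 1`): if `ρ ≥ 6` and `y/ρ³ + y²/ρ⁴ + 54y/ρ⁴ + 54y²/ρ⁵ ≤ 1` then `A_n(y) ≤ 27 y⁴ · ρⁿ` for every `n`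
(strong induction on the recursion; the base `n ≤ 3` from `A_n ≤ c_n y^{n+1} ≤ 27 y⁴`).
[cite: HammersleyTorrieWhittington1982, §2 (as summarised by Beaton 2014 arXiv v3 p. 11; locator provisional); MadrasSlade1993, §1.2, Lemma 1.2.2] -/
theorem Aw_le_mul_pow (hy : 1 ≤ y) {ρ : ℝ} (hρ : 6 ≤ ρ)
    (hc : y / ρ ^ 3 + y ^ 2 / ρ ^ 4 + 54 * y / ρ ^ 4 + 54 * y ^ 2 / ρ ^ 5 ≤ 1) (n : ℕ) :
    Aw n y ≤ 27 * y ^ 4 * ρ ^ n := by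
  have hy0 : 0 ≤ y := by linarith
  have hρ1 : 1 ≤ ρ := by linarith
  have hρ0 : 0 < ρ := by linarith
  induction n using Nat.strong_induction_on with
  | _ n ih =>
  rcases Nat.lt_or_ge n 4 with hn | hn
  · have h1 := Aw_le_card_mul_pow n hy0
    rw [max_eq_right hy] at h1
    have h2 : (#(saws n) : ℝ) * y ^ (n + 1) ≤ 3 ^ n * y ^ (n + 1) :=
      mul_le_mul_of_nonneg_right (card_saws_le_three_pow n) (pow_nonneg hy0 _)
    have h3 : (3 : ℝ) ^ n ≤ 27 := by
      calc (3 : ℝ) ^ n ≤ 3 ^ 3 := pow_le_pow_right₀ (by norm_num) (by omega)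
        _ = 27 := by norm_num
    have h4 : y ^ (n + 1) ≤ y ^ 4 := pow_le_pow_right₀ hy (by omega)
    have h5 : (1 : ℝ) ≤ ρ ^ n := one_le_pow₀ hρ1
    calc Aw n y ≤ 3 ^ n * y ^ (n + 1) := h1.trans h2
      _ ≤ 27 * y ^ 4 := mul_le_mul h3 h4 (pow_nonneg hy0 _) (by norm_num)
      _ = 27 * y ^ 4 * 1 := (mul_one _).symm
      _ ≤ 27 * y ^ 4 * ρ ^ n := mul_le_mul_of_nonneg_left h5 (by positivity)
  · obtain ⟨m, rfl⟩ : ∃ m, n = m + 4 := ⟨n - 4, by omega⟩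
    set M : ℝ := 27 * y ^ 4 with hM
    have hM0 : 0 ≤ M := by positivity
    have hrec := Aw_le_rec m hy0
    have b1 : Aw (m + 1) y ≤ M * ρ ^ (m + 1) := ih (m + 1) (by omega)
    have b0 : Aw m y ≤ M * ρ ^ m := ih m (by omega)
    have bS1 : ∑ k ∈ range (m + 1), Aw k y * (#(saws (m + 3 - k)) : ℝ) ≤ M * (54 * ρ ^ m) := by
      calc ∑ k ∈ range (m + 1), Aw k y * (#(saws (m + 3 - k)) : ℝ)
          ≤ ∑ k ∈ range (m + 1), M * ρ ^ k * 3 ^ (m + 3 - k) :=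
            Finset.sum_le_sum fun k hk => mul_le_mul (ih k (by have := Finset.mem_range.1 hk; omega))
              (card_saws_le_three_pow _) (by positivity) (by positivity)
        _ = M * ∑ k ∈ range (m + 1), ρ ^ k * 3 ^ (m + 3 - k) := by
            rw [Finset.mul_sum]; exact Finset.sum_congr rfl fun k _ => by ring
        _ ≤ M * (2 * 3 ^ 3 * ρ ^ m) := mul_le_mul_of_nonneg_left (sum_pow_mul_three_pow_le hρ m 3) hM0
        _ = M * (54 * ρ ^ m) := by norm_num
    have bS2 : ρ * ∑ k ∈ range m, Aw k y * (#(saws (m + 2 - k)) : ℝ) ≤ M * (54 * ρ ^ m) := by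
      cases m with
      | zero => simp only [Finset.range_zero, Finset.sum_empty, mul_zero]; positivity
      | succ m' =>
        calc ρ * ∑ k ∈ range (m' + 1), Aw k y * (#(saws (m' + 1 + 2 - k)) : ℝ)
            ≤ ρ * ∑ k ∈ range (m' + 1), M * ρ ^ k * 3 ^ (m' + 3 - k) := by
              refine mul_le_mul_of_nonneg_left (Finset.sum_le_sum fun k hk => ?_) hρ0.le
              rw [show m' + 1 + 2 - k = m' + 3 - k by omega]
              exact mul_le_mul (ih k (by have := Finset.mem_range.1 hk; omega)) (card_saws_le_three_pow _)
                (by positivity) (by positivity)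
          _ = ρ * (M * ∑ k ∈ range (m' + 1), ρ ^ k * 3 ^ (m' + 3 - k)) := by
              congr 1
              rw [Finset.mul_sum]
              exact Finset.sum_congr rfl fun k _ => by ring
          _ ≤ ρ * (M * (2 * 3 ^ 3 * ρ ^ m')) :=
              mul_le_mul_of_nonneg_left (mul_le_mul_of_nonneg_left (sum_pow_mul_three_pow_le hρ m' 3) hM0) hρ0.le
          _ = M * (54 * ρ ^ (m' + 1)) := by ring
    have key : y * ρ ^ (m + 1) + y ^ 2 * ρ ^ m + 54 * y * ρ ^ m + 54 * y ^ 2 * ρ ^ m / ρ ≤ ρ ^ (m + 4) := by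
      have h := mul_le_mul_of_nonneg_right hc (pow_nonneg hρ0.le (m + 4))
      rw [one_mul] at h
      have e : (y / ρ ^ 3 + y ^ 2 / ρ ^ 4 + 54 * y / ρ ^ 4 + 54 * y ^ 2 / ρ ^ 5) * ρ ^ (m + 4) =
          y * ρ ^ (m + 1) + y ^ 2 * ρ ^ m + 54 * y * ρ ^ m + 54 * y ^ 2 * ρ ^ m / ρ := by
        field_simp
        ring
      linarith
    have c1 : y * Aw (m + 1) y ≤ y * (M * ρ ^ (m + 1)) := mul_le_mul_of_nonneg_left b1 hy0
    have c2 : y * ∑ k ∈ range (m + 1), Aw k y * (#(saws (m + 3 - k)) : ℝ) ≤ y * (M * (54 * ρ ^ m)) :=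
      mul_le_mul_of_nonneg_left bS1 hy0
    have c3 : y * (y * Aw m y) ≤ y * (y * (M * ρ ^ m)) :=
      mul_le_mul_of_nonneg_left (mul_le_mul_of_nonneg_left b0 hy0) hy0
    have c4 : y * (y * ∑ k ∈ range m, Aw k y * (#(saws (m + 2 - k)) : ℝ)) ≤ y ^ 2 / ρ * (M * (54 * ρ ^ m)) := by
      have h := mul_le_mul_of_nonneg_left bS2 (show (0 : ℝ) ≤ y ^ 2 / ρ by positivity)
      calc y * (y * ∑ k ∈ range m, Aw k y * (#(saws (m + 2 - k)) : ℝ))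
          = y ^ 2 / ρ * (ρ * ∑ k ∈ range m, Aw k y * (#(saws (m + 2 - k)) : ℝ)) := by
            field_simp
        _ ≤ y ^ 2 / ρ * (M * (54 * ρ ^ m)) := h
    have key' := mul_le_mul_of_nonneg_left key hM0
    calc Aw (m + 4) y ≤ y * Aw (m + 1) y + y * ∑ k ∈ range (m + 1), Aw k y * (#(saws (m + 3 - k)) : ℝ) +
          y * (y * Aw m y + y * ∑ k ∈ range m, Aw k y * (#(saws (m + 2 - k)) : ℝ)) := hrec
      _ ≤ y * (M * ρ ^ (m + 1)) + y * (M * (54 * ρ ^ m)) + (y * (y * (M * ρ ^ m)) + y ^ 2 / ρ * (M * (54 * ρ ^ m))) := by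
          rw [mul_add y (y * Aw m y)]; linarith
      _ = M * (y * ρ ^ (m + 1) + y ^ 2 * ρ ^ m + 54 * y * ρ ^ m + 54 * y ^ 2 * ρ ^ m / ρ) := by
          field_simp
          ring
      _ ≤ M * ρ ^ (m + 4) := key'

/-! ### From the growth bound to the rate: `β_rot(y) ≤ √y / (1 − 109/√y)` -/

/-- **Fekete transfer**: an exponential bound `B^w_n(y) ≤ M ρⁿ` for all `n` gives `β_rot(y) ≤ ρ`. [cite: MadrasSlade1993, §1.2, Lemma 1.2.2 and (1.2.17)] -/
theorem armRate_le_of_WB_le (hy : 0 < y) {M ρ : ℝ} (hM : 0 < M) (hρ : 0 < ρ) (h : ∀ n, WB n y ≤ M * ρ ^ n) :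
    armRate y ≤ ρ := by
  have hlim := tendsto_armU_div hy
  have hb : Tendsto (fun k : ℕ => (-Real.log M + 3 * Real.log ρ) / (k : ℝ) - 4 * Real.log ρ) atTop
      (𝓝 (0 - 4 * Real.log ρ)) :=
    (tendsto_const_div_atTop_nhds_zero_nat _).sub tendsto_const_nhds
  rw [zero_sub] at hb
  have hle : ∀ᶠ k : ℕ in atTop, (-Real.log M + 3 * Real.log ρ) / (k : ℝ) - 4 * Real.log ρ ≤ armU y k / k := by
    filter_upwards [eventually_ge_atTop 1] with k hk
    have hk0 : (0 : ℝ) < k := by exact_mod_cast hk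
    have hpos := wseq_pos hy k
    have h1 : wseq y k ≤ M * ρ ^ (4 * k - 3) := by rw [wseq, if_neg (by omega)]; exact h _
    have h2 : Real.log (wseq y k) ≤ Real.log M + ((4 * k - 3 : ℕ) : ℝ) * Real.log ρ := by
      calc Real.log (wseq y k) ≤ Real.log (M * ρ ^ (4 * k - 3)) := Real.log_le_log hpos h1
        _ = Real.log M + ((4 * k - 3 : ℕ) : ℝ) * Real.log ρ := by
            rw [Real.log_mul hM.ne' (pow_ne_zero _ hρ.ne'), Real.log_pow]
    have hcast : ((4 * k - 3 : ℕ) : ℝ) = 4 * k - 3 := by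
      rw [Nat.cast_sub (by omega)]; push_cast; ring
    rw [hcast] at h2
    rw [armU, le_div_iff₀ hk0]
    have e : ((-Real.log M + 3 * Real.log ρ) / (k : ℝ) - 4 * Real.log ρ) * k = -Real.log M - (4 * k - 3) * Real.log ρ := by
      field_simp
      ring
    rw [e]
    linarith
  have hge : -(4 * Real.log ρ) ≤ armLogLim y := le_of_tendsto_of_tendsto hb hlim hle
  rw [armRate]
  calc Real.exp (-(armLogLim y) / 4) ≤ Real.exp (Real.log ρ) := Real.exp_le_exp.2 (by linarith)
    _ = ρ := Real.exp_log hρ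

/-- **`β_rot(y) ≤ √y / (1 − 109/√y)` for `y > 109²`.** [cite: Beaton2014RotatedHoneycomb, Proposition 7 (arXiv v3 p. 11: "μ(y) ≥ max{μ, √y}" — the matching lower bound); RychlewskiWhittington2011, Theorem (hypercubic analogue "μ(y) is asymptotic to y"; not held); BeatonBousquetMelouDeGierDuminilCopinGuttmann2014, §3.1 (arXiv v5 p. 10: "This translates into μ(y) ∼ √y in our honeycomb setting", zig-zag boundary)] -/
theorem armRate_le_sqrt_div (hy : (109 : ℝ) ^ 2 < y) : armRate y ≤ Real.sqrt y / (1 - 109 / Real.sqrt y) := by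
  set s := Real.sqrt y with hs
  have hy0 : 0 < y := lt_trans (by norm_num) hy
  have hs109 : 109 < s := by
    rw [hs, ← Real.sqrt_sq (by norm_num : (0 : ℝ) ≤ 109)]
    exact Real.sqrt_lt_sqrt (by positivity) hy
  have hs0 : 0 < s := by linarith
  have hs1 : 1 ≤ s := by linarith
  have hsy : s ^ 2 = y := by rw [hs]; exact Real.sq_sqrt hy0.le
  have hy1 : 1 ≤ y := by nlinarith
  set q := 109 / s with hq
  have hq1 : q < 1 := by rw [hq, div_lt_one hs0]; exact hs109
  have h1q : 0 < 1 - q := by linarith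
  have hq0 : 0 < q := by positivity
  have h1q' : 1 - q ≤ 1 := by linarith
  set ρ := s / (1 - q) with hρdef
  have hρs : s ≤ ρ := by
    rw [hρdef, le_div_iff₀ h1q]
    nlinarith
  have hρ6 : 6 ≤ ρ := by linarith
  have hρ0 : 0 < ρ := by linarith
  have hc : y / ρ ^ 3 + y ^ 2 / ρ ^ 4 + 54 * y / ρ ^ 4 + 54 * y ^ 2 / ρ ^ 5 ≤ 1 := by
    have p3 : s ^ 3 ≤ ρ ^ 3 := pow_le_pow_left₀ hs0.le hρs 3
    have p4 : s ^ 4 ≤ ρ ^ 4 := pow_le_pow_left₀ hs0.le hρs 4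
    have p5 : s ^ 5 ≤ ρ ^ 5 := pow_le_pow_left₀ hs0.le hρs 5
    have t1 : y / ρ ^ 3 ≤ 1 / s := by
      rw [div_le_div_iff₀ (by positivity) hs0, ← hsy]
      nlinarith
    have t2 : y ^ 2 / ρ ^ 4 ≤ 1 - q := by
      have e : y ^ 2 / ρ ^ 4 = (1 - q) ^ 4 := by
        rw [hρdef, div_pow, ← hsy]
        field_simp
      rw [e]
      calc (1 - q) ^ 4 ≤ (1 - q) ^ 1 := pow_le_pow_of_le_one h1q.le h1q' (by norm_num)
        _ = 1 - q := pow_one _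
    have t3 : 54 * y / ρ ^ 4 ≤ 54 / s := by
      rw [div_le_div_iff₀ (by positivity) hs0, ← hsy]
      have h34 : s ^ 2 * s ≤ ρ ^ 4 := by
        calc s ^ 2 * s = s ^ 3 := by ring
          _ ≤ s ^ 4 := pow_le_pow_right₀ hs1 (by norm_num)
          _ ≤ ρ ^ 4 := p4
      nlinarith [h34]
    have t4 : 54 * y ^ 2 / ρ ^ 5 ≤ 54 / s := by
      rw [div_le_div_iff₀ (by positivity) hs0, ← hsy]
      nlinarith
    have hsum : 1 / s + 54 / s + 54 / s = q := by rw [hq]; ring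
    linarith
  have hA := Aw_le_mul_pow hy1 hρ6 hc
  have hW : ∀ n, WB n y ≤ 27 * y ^ 4 * ρ ^ n := fun n => (WB_le_Aw n hy0.le).trans (hA n)
  exact armRate_le_of_WB_le hy0 (by positivity) hρ0 hW

/-- The same bound on the fourth power without the quotient: `β_rot(y) · (1 − 109/√y) ≤ √y`. [cite: Beaton2014RotatedHoneycomb, Proposition 7 (arXiv v3 p. 11)] -/
theorem armRate_mul_le_sqrt (hy : (109 : ℝ) ^ 2 < y) : armRate y * (1 - 109 / Real.sqrt y) ≤ Real.sqrt y := by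
  have hs109 : 109 < Real.sqrt y := by
    rw [← Real.sqrt_sq (by norm_num : (0 : ℝ) ≤ 109)]
    exact Real.sqrt_lt_sqrt (by positivity) hy
  have h1q : 0 < 1 - 109 / Real.sqrt y := by
    have : 109 / Real.sqrt y < 1 := (div_lt_one (by linarith)).2 hs109
    linarith
  exact (le_div_iff₀ h1q).1 (armRate_le_sqrt_div hy)

/-! ### The lower bound `√y ≤ β_rot(y)` (re-derived) and the limit `β_rot(y)/√y → 1` -/

/-- `y² ≤ B^w_1(y)`: the dimer step `(0,0) → (0,1)` (re-derivation of the rider-E lemma, kept private here).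
[cite: Beaton2014RotatedHoneycomb, §3.1, proof of Proposition 7 (arXiv v3 p. 14: "walks which step along the surface")] -/
private theorem sq_le_WB_one_aux (hy : 0 < y) : y ^ 2 ≤ WB 1 y := by
  have hmem := zzWalk_mem_wb 0
  rw [show 4 * 0 + 1 = 1 by norm_num] at hmem
  have hv : visits 1 (zzWalk 1) = 2 := by
    rw [show (1 : ℕ) = 0 + 1 from rfl, visits_succ, visits_zero]
    have a0 : zzWalk 1 0 0 = 0 := by
      rcases zz_zero_cases 0 with ⟨h, -⟩ | ⟨-, h⟩
      · simpa [zzWalk] using h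
      · omega
    have a1 : zzWalk 1 (0 + 1) 0 = 0 := by
      rcases zz_zero_cases 1 with ⟨h, -⟩ | ⟨-, h⟩
      · simpa [zzWalk] using h
      · omega
    rw [if_pos a0, if_pos a1]
  rw [WB]
  calc y ^ 2 = y ^ visits 1 (zzWalk 1) := by rw [hv]
    _ ≤ ∑ ω ∈ wb 1, y ^ visits 1 ω := Finset.single_le_sum (fun _ _ => pow_nonneg hy.le _) hmem

/-- `√y ≤ β_rot(y)` (re-derivation of rider E's `sqrt_le_armRate`, kept private here: `y² ≤ B^w_1 = d_1 ≤ β_rot⁴`).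
[cite: Beaton2014RotatedHoneycomb, Proposition 7 (arXiv v3 p. 11: "μ(y) ≥ max{μ, √y}")] -/
private theorem sqrt_le_armRate_aux (hy : 0 < y) : Real.sqrt y ≤ armRate y := by
  have hβ := armRate_pos y
  have h1 : y ^ 2 ≤ (armRate y ^ 2) ^ 2 := by
    have h := wseq_le_pow hy 1
    rw [wseq, if_neg one_ne_zero, show 4 * 1 - 3 = 1 by norm_num, pow_one] at h
    calc y ^ 2 ≤ WB 1 y := sq_le_WB_one_aux hy
      _ ≤ armRate y ^ 4 := h
      _ = (armRate y ^ 2) ^ 2 := by ring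
  have h2 : y ≤ armRate y ^ 2 := (pow_le_pow_iff_left₀ hy.le (sq_nonneg _) two_ne_zero).1 h1
  calc Real.sqrt y ≤ Real.sqrt (armRate y ^ 2) := Real.sqrt_le_sqrt h2
    _ = armRate y := Real.sqrt_sq hβ.le

/-- **`1 ≤ β_rot(y)/√y`** for `y > 0`. [cite: Beaton2014RotatedHoneycomb, Proposition 7 (arXiv v3 p. 11: "μ(y) ≥ max{μ, √y}")] -/
theorem one_le_armRate_div_sqrt (hy : 0 < y) : 1 ≤ armRate y / Real.sqrt y :=
  (one_le_div (Real.sqrt_pos.2 hy)).2 (sqrt_le_armRate_aux hy)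

/-- **`β_rot(y)/√y ≤ 1/(1 − 109/√y)`** for `y > 109²`. [cite: Beaton2014RotatedHoneycomb, Proposition 7 (arXiv v3 p. 11)] -/
theorem armRate_div_sqrt_le (hy : (109 : ℝ) ^ 2 < y) : armRate y / Real.sqrt y ≤ 1 / (1 - 109 / Real.sqrt y) := by
  have hs0 : 0 < Real.sqrt y := Real.sqrt_pos.2 (lt_trans (by norm_num) hy)
  rw [div_le_iff₀ hs0]
  calc armRate y ≤ Real.sqrt y / (1 - 109 / Real.sqrt y) := armRate_le_sqrt_div hy
    _ = 1 / (1 - 109 / Real.sqrt y) * Real.sqrt y := by ring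

/-- **`β_rot(y)/√y → 1` as `y → ∞`**: the adsorbed phase of Beaton's rotated model is entropy-free at leading order — the armchair-boundary
analogue of Rychlewski–Whittington's `μ(y) ∼ y` (hypercubic) and of BBdGDCG's unproved remark `μ(y) ∼ √y` (zig-zag boundary).
[cite: Beaton2014RotatedHoneycomb, Proposition 7 (arXiv v3 p. 11: "μ(y) ≥ max{μ, √y}" — here with the matching upper bound); RychlewskiWhittington2011, Theorem (hypercubic analogue; not held); BeatonBousquetMelouDeGierDuminilCopinGuttmann2014, §3.1 (arXiv v5 p. 10: "This translates into μ(y) ∼ √y in our honeycomb setting")] -/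
theorem tendsto_armRate_div_sqrt : Tendsto (fun y : ℝ => armRate y / Real.sqrt y) atTop (𝓝 1) := by
  have hup : Tendsto (fun y : ℝ => 1 / (1 - 109 / Real.sqrt y)) atTop (𝓝 1) := by
    have h1 : Tendsto (fun y : ℝ => 109 / Real.sqrt y) atTop (𝓝 0) := by
      have h := (tendsto_inv_atTop_zero.comp Real.tendsto_sqrt_atTop).const_mul 109
      rw [mul_zero] at h
      refine h.congr fun y => ?_
      simp only [Function.comp, div_eq_mul_inv]
    have h2 : Tendsto (fun y : ℝ => 1 - 109 / Real.sqrt y) atTop (𝓝 (1 - 0)) := tendsto_const_nhds.sub h1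
    rw [sub_zero] at h2
    have h3 := h2.inv₀ one_ne_zero
    rw [inv_one] at h3
    refine h3.congr fun y => ?_
    simp only [one_div]
  refine tendsto_of_tendsto_of_tendsto_of_le_of_le' tendsto_const_nhds hup ?_ ?_
  · filter_upwards [eventually_gt_atTop (0 : ℝ)] with y hy using one_le_armRate_div_sqrt hy
  · filter_upwards [eventually_gt_atTop ((109 : ℝ) ^ 2)] with y hy using armRate_div_sqrt_le hy

/-- **`log β_rot(y) − ½ log y → 0`**: no residual entropy in the adsorbed phase at leading order.
[cite: Beaton2014RotatedHoneycomb, Proposition 7 (arXiv v3 p. 11)] -/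
theorem tendsto_log_armRate_sub_half_log : Tendsto (fun y : ℝ => Real.log (armRate y) - Real.log y / 2) atTop (𝓝 0) := by
  have h := ((Real.continuousAt_log one_ne_zero).tendsto.comp tendsto_armRate_div_sqrt)
  rw [Real.log_one] at h
  refine h.congr' ?_
  filter_upwards [eventually_gt_atTop (0 : ℝ)] with y hy
  simp only [Function.comp_def]
  rw [Real.log_div (armRate_pos y).ne' (Real.sqrt_pos.2 hy).ne', Real.log_sqrt hy.le]

end Literature.Probability.RandomPlanarGeometry.SAW.HexBW.Arm
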